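import Mathlib

/-!
# Pentagon NL relation = tangency to the triple-point discriminant cubic (solo-blind, s164)

Net of plane sections of the six-line family: `E_g : y₁³ + y₂³ − y₃³ − m·y₁y₂y₃ = 0` with `m = g·s`,
`s = ψ/2`; triple-point discriminant cubic `H₊₊₊ : y₁³ + y₂³ + y₃³ − s·y₁y₂y₃ = 0`.

* `hesseDiff_factor` : `H₊₊₊ − E_g = y₃ · (2y₃² − (s − m)·y₁y₂)`, so `E_g ∩ H₊₊₊` is the three axis points
  `y₃ = 0` plus `E_g ∩ Q`, `Q` the conic `2y₃² = (s − m)y₁y₂`.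
* `pentagon_on_conic` : in the chart `y₃ = 1`, on `Q` (i.e. `(s − m)·y₁y₂ = 2`) the cubic `E_g` becomes, after
  multiplying by `s − m`, `(s − m)(y₁³ + y₂³) − (s + m)`; so `u = y₁`, `v = y₂` satisfy
  `u³ + v³ = (s+m)/(s−m)`, `u·v = 2/(s−m)`, and `u³`, `v³` are the two roots of `Z² − λZ + c³`,
  `λ = (s+m)/(s−m)`, `c = 2/(s−m)`.
* `conic_discriminant` : the discriminant `λ² − 4c³` equals `((s+m)²(s−m) − 32)/(s−m)³`.
* `discriminant_numerator_eq` : with `m = g·s` the numerator is `s³(1+g)²(1−g) − 32`.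
* `nl_relation_rescale` : `ψ = 2s` turns `s³(1+g)²(1−g) = 32` into `ψ³(1+g)²(1−g) = 256`, the pentagon
  Noether–Lefschetz relation (HESSE-PENT (ii), cf. `SoloBlindHesseFamily`).

Hence the six points `E_g ∩ Q` coalesce in pairs — `E_g` is tangent to `H₊₊₊` at three points — exactly on
the pentagon NL relation.  Everything here is a polynomial identity; the geometric reading is in the
programme notes (paper/siblings.md, REMARK (r3)).
-/

namespace Summit.HodgeConjecture.HodgeConjecture.Theorems

/-- `H₊₊₊ − E_g` factors through the axis `y₃ = 0` and the conic `2y₃² = (s − m)y₁y₂`. -/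
theorem hesseDiff_factor {R : Type*} [CommRing R] (s m y₁ y₂ y₃ : R) :
    (y₁ ^ 3 + y₂ ^ 3 + y₃ ^ 3 - s * (y₁ * y₂ * y₃)) - (y₁ ^ 3 + y₂ ^ 3 - y₃ ^ 3 - m * (y₁ * y₂ * y₃))
      = y₃ * (2 * y₃ ^ 2 - (s - m) * (y₁ * y₂)) := by
  ring

/-- On the conic (chart `y₃ = 1`): `(s − m)·E_g = (s − m)(y₁³ + y₂³) − (s + m)`. -/
theorem pentagon_on_conic {R : Type*} [CommRing R] (s m y₁ y₂ : R)
    (hQ : (s - m) * (y₁ * y₂) = 2) :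
    (s - m) * (y₁ ^ 3 + y₂ ^ 3 - 1 - m * (y₁ * y₂ * 1))
      = (s - m) * (y₁ ^ 3 + y₂ ^ 3) - (s + m) := by
  linear_combination (-m) * hQ

/-- Vieta data on the conic: the product of the cubes is the cube of `2/(s − m)`. -/
theorem pentagon_on_conic_vieta {K : Type*} [Field K] (s m y₁ y₂ : K) (hsm : s - m ≠ 0)
    (hQ : (s - m) * (y₁ * y₂) = 2) :
    y₁ ^ 3 * y₂ ^ 3 = (2 / (s - m)) ^ 3 ∧
      ((s - m) * (y₁ ^ 3 + y₂ ^ 3 - 1 - m * (y₁ * y₂ * 1)) = 0 ↔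
        y₁ ^ 3 + y₂ ^ 3 = (s + m) / (s - m)) := by
  have hy : y₁ * y₂ = 2 / (s - m) := by
    field_simp
    linear_combination hQ
  constructor
  · rw [← mul_pow, hy]
  · rw [pentagon_on_conic s m y₁ y₂ hQ]
    constructor
    · intro h
      field_simp
      linear_combination h
    · intro h
      rw [h]
      field_simp
      ring

/-- Discriminant of `Z² − λZ + c³` with `λ = (s+m)/(s−m)`, `c = 2/(s−m)`. -/
theorem conic_discriminant {K : Type*} [Field K] (s m : K) (hsm : s - m ≠ 0) :
    ((s + m) / (s - m)) ^ 2 - 4 * (2 / (s - m)) ^ 3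
      = ((s + m) ^ 2 * (s - m) - 32) / (s - m) ^ 3 := by
  field_simp
  ring

/-- With `m = g·s` the discriminant numerator is `s³(1+g)²(1−g) − 32`. -/
theorem discriminant_numerator_eq {R : Type*} [CommRing R] (s g : R) :
    (s + g * s) ^ 2 * (s - g * s) - 32 = s ^ 3 * (1 + g) ^ 2 * (1 - g) - 32 := by
  ring

/-- `ψ = 2s`: the vanishing of the numerator is the pentagon NL relation `ψ³(1+g)²(1−g) = 256`. -/
theorem nl_relation_rescale {R : Type*} [CommRing R] (s g : R) :
    (2 * s) ^ 3 * (1 + g) ^ 2 * (1 - g) - 256 = 8 * (s ^ 3 * (1 + g) ^ 2 * (1 - g) - 32) := by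
  ring

/-- Summary over a field of characteristic `≠ 2`: for `m = g·s`, `s ≠ m`, the quadratic
`Z² − λZ + c³` governing `E_g ∩ Q` has vanishing discriminant iff the pentagon NL relation holds
for `ψ = 2s`. -/
theorem tangency_iff_nl {K : Type*} [Field K] [NeZero (2 : K)] (s g : K) (hsm : s - g * s ≠ 0) :
    ((s + g * s) / (s - g * s)) ^ 2 - 4 * (2 / (s - g * s)) ^ 3 = 0 ↔
      (2 * s) ^ 3 * (1 + g) ^ 2 * (1 - g) = 256 := by
  rw [conic_discriminant s (g * s) hsm, div_eq_zero_iff]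
  have h3 : (s - g * s) ^ 3 ≠ 0 := pow_ne_zero 3 hsm
  have h8 : (8 : K) ≠ 0 := by
    have h2 : (2 : K) ≠ 0 := NeZero.ne 2
    have : (8 : K) = 2 * 2 * 2 := by norm_num
    rw [this]
    exact mul_ne_zero (mul_ne_zero h2 h2) h2
  constructor
  · intro h
    rcases h with h | h
    · have := nl_relation_rescale s g
      rw [discriminant_numerator_eq] at h
      linear_combination this + 8 * h
    · exact absurd h h3
  · intro h
    left
    rw [discriminant_numerator_eq]
    have key := nl_relation_rescale s g
    have : 8 * (s ^ 3 * (1 + g) ^ 2 * (1 - g) - 32) = 0 := by linear_combination -key + h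
    rcases mul_eq_zero.mp this with h' | h'
    · exact absurd h' h8
    · exact h'

end Summit.HodgeConjecture.HodgeConjecture.Theorems
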